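import Literature.IUT.HodgeArakelov.IotaInvariantThetaInftyOrbitFinite
import Literature.AnabelianGeometry.EtaleTheta.SettingModelTateDoubleUnderline
import Literature.AnabelianGeometry.EtaleTheta.Discharge.Sec1CompatHolds
import HarnessLib

/-!
# [IUTchII] Prop. 1.5 (iii) closers AT THE [EtTh] STAGE-2 MODEL FAMILY `ThetaSetting.modelχq p i j` — the
# `IsEtThOrigin` / `Compat` binders SUPPLIED (proof-only; C-R33 / K4 RE-CLOSE sibling, node `IUTchII:Prop1.5(iii)`)

S. Mochizuki, *Inter-universal Teichmüller theory II*, kurims manuscript (Dec. 2020), §1 Prop. 1.5 (iii) p. 29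
[claim: Mochizuki2012, status: disputed] (IUTchII §1 Prop 1.5 (iii), kurims p.29; D-0012 claim key — NOTHING of the
series is asserted here); S. Mochizuki, *The étale theta function …*, Publ. RIMS **45** (2009) [EtTh], §1 p. 12,
Prop. 1.5 (iii) p. 23 (PRIMS PDF pages) [cite: MochizukiEtTh2009, Prop 1.5 (iii) p.23].
Cell `abc-iut`, seat abc-iut-w5-d162 (gen 7); R-C letter K / plan C-R33 «K4 RE-CLOSE» row «K4-RECLOSE-L6-IUTchII»
(abc-iut-c312-2 `CONE-K4-RECLOSE.tsv` v3: node `IUTchII:Prop1.5(iii)`, class RECLOSABLE, refuted-closure binder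
F-2498 `ThetaSetting.IsEtThOrigin` of the closer `EtaleThetaDataOfSetting.conj_rootLift_div_mem_range_pow`
(abc-iut-w5-d163, `IotaInvariantThetaInftyOrbitFinite.lean`); CLOSED producer `ThetaSetting.modelχq_isEtThOrigin`
(abc-iut-L2-t5, `SettingModelTateTheta.lean`)).  PROOF-ONLY: no definition, no instance, no new named fact; the
original closers are untouched and consumed BY NAME.

WHAT IS PROVED.  Over the stage-2 model family `D := ThetaSetting.modelχq p i j hj` of the [EtTh] §1 interface
(abc-iut-L2-t5: `K = ℚ_p`, `Π^tp_X = (F̂₂ ×_Ẑ ℤ) ⋊_{χ-shear} G_{ℚ_p}`, `q`-parameter `p^j`; every prime `p`, every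
`i`, every even `j`), for EVERY étale-theta datum `E` over `D` and EVERY choice `C` of `X̲̲`:
* `conj_rootLift_div_mem_range_pow_modelχq` — the pointwise comparison of two conjugates of abc-iut-L6-t1's root
  cocycle `rootLiftCocycle C` on `Π^tp_Ÿ̲̲ ∩ chiKer(M)` up to `N`-th powers of `l·Δ_Θ` (`M = lN`), i.e. the closer
  `conj_rootLift_div_mem_range_pow` with BOTH `Prop`-fact binders supplied by theorems of the tree: `hC` by
  abc-iut-w5-d017's `ThetaSetting.compat` (F-2491, proved for every setting) and `hO : D.IsEtThOrigin` (F-2498, whose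
  universal closure is REFUTED in the tree, `ThetaSetting.not_forall_isEtThOrigin_univ`) by the CLOSED producer
  `ThetaSetting.modelχq_isEtThOrigin` — ZERO `Prop`-fact binders remain (the remaining binders are the printed data
  `E`, `C`, `μ`, `σ`, `σ₀`, `y`, `g` and the printed hypotheses `hMN`, `hy`, `hg` of the statement itself);
* `conj_etaDd_eq_mul_pow_modelχq` — the companion class identity `σ·η̈^Θ = σ₀·η̈^Θ · y^M` (closer
  `conj_etaDd_eq_mul_pow`, whose only flagged binder is the structure-borne field F-2551 `IsProfiniteCompletion` of
  the setting — at `modelχq` a CONSTRUCTED datum) with `hC` supplied.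
Technical note: at the concrete (reducible) model carrier the generic instances `ThetaSetting.lDeltaTheta_normal` /
`EtaleThetaDataOfSetting.instIsMulCommutative_lDeltaTheta` are not found by instance search (discrimination-tree keys of the unfolded
carrier, cf. abc-iut-w5-d072's note in `BadPrimeGaussianMonoidsGenuineRecordAtModelTate`); they are supplied BY NAME
with `haveI` in the statement (`Prop`-valued classes, so the statement is the closer's statement at `D := modelχq`
verbatim); the `Δ_Θ` instances at `modelχq` are abc-iut-L2-d1's re-exports (`SettingModelTateDoubleUnderline`).
Node-level reading (C-R33): at the genuine (non-toy) carrier family `modelχq p i j` the node's two closing theorems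
hold with no refuted-closure FACT head bound.

HONEST LABEL: `modelχq` is a SEMI-SYNTHETIC model of the typed [EtTh] §1 interface (not the tempered `π₁` of a
curve): this is joint-satisfiability / instance-form evidence (OUR kernel check that the closers' hypotheses are
realised TOGETHER at one genuine carrier), not a claim about print; re-closed-at-a-carrier ≠ proved-in-print; no
side is taken on [IUTchIII] Cor. 3.12; typed ≠ proved; nothing here says abc is proved or refuted.
-/

noncomputable section

namespace Literature.IUT.HodgeArakelov

open Literature.AnabelianGeometry.EtaleTheta Literature.AnabelianGeometry.SemiGraphs
open CohomologySystemOfContH1 EtaleThetaDataOfSetting DivisibleLevel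
open Literature.IUT.LogVolume

namespace EtaleThetaDataOfSetting

variable (p : ℕ) [Fact p.Prime] (i j : ℤ) (hj : Even j)
  {E : (ThetaSetting.modelχq p i j hj).EtaleThetaData} {l : ℕ} (C : E.DoubleUnderline l)

open scoped IsMulCommutative

/-- **[IUTchII] Prop. 1.5 (iii) closer `conj_etaDd_eq_mul_pow` AT THE STAGE-2 MODEL FAMILY `modelχq p i j`, `Compat`
supplied** (abc-iut-w5-d017's `ThetaSetting.compat`): two conjugates of the lifted theta class with congruent
parameters differ by an `M`-th power in `H¹(Π^tp_Ÿ, Δ_Θ)`, for every étale-theta datum `E` over the model.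
[claim: Mochizuki2012, status: disputed] (IUTchII §1 Prop 1.5 (iii), kurims p.29)
[cite: MochizukiEtTh2009, Prop 1.5 (iii) p.23] -/
theorem conj_etaDd_eq_mul_pow_modelχq
    {x' : (ThetaSetting.modelχq p i j hj).H1Theta
      ((ThetaSetting.modelχq p i j hj).GtpYdd.map (ThetaSetting.modelχq p i j hj).toTheta)}
    (hx' : (ThetaSetting.modelχq p i j hj).inflTheta (ThetaSetting.modelχq p i j hj).GtpYdd x' = E.etaDd)
    {σ σ₀ : (ThetaSetting.modelχq p i j hj).PiTemp}
    {uσ uσ₀ sU vU vU₀ : (↥(ThetaSetting.modelχq p i j hj).Kdd)ˣ} {M : ℕ} {k : ℤ}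
    (ha : Multiplicative.toAdd ((ThetaSetting.modelχq p i j hj).toZ σ) =
      Multiplicative.toAdd ((ThetaSetting.modelχq p i j hj).toZ σ₀) + M * k)
    (huσ : uσ = sU * vU ^ M) (huσ₀ : uσ₀ = sU * vU₀ ^ M)
    (hσ : haveI := (ThetaSetting.modelχq p i j hj).compat.GtpYddTheta_normal
      ContH1.conj (MonoidHom.id (ThetaSetting.modelχq p i j hj).GtpTheta) (ThetaSetting.modelχq p i j hj).DeltaTheta
          ((ThetaSetting.modelχq p i j hj).toTheta σ) x' =
        x' * (E.logUdd ^ (-(2 * Multiplicative.toAdd ((ThetaSetting.modelχq p i j hj).toZ σ)))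
          * E.kumYdd (E.toKddHat (ThetaSetting.modelχq p i j hj).qddUnit) ^
              (-(Multiplicative.toAdd ((ThetaSetting.modelχq p i j hj).toZ σ) *
                Multiplicative.toAdd ((ThetaSetting.modelχq p i j hj).toZ σ)))
          * E.kumYdd (E.toKddHat uσ)))
    (hσ₀ : haveI := (ThetaSetting.modelχq p i j hj).compat.GtpYddTheta_normal
      ContH1.conj (MonoidHom.id (ThetaSetting.modelχq p i j hj).GtpTheta) (ThetaSetting.modelχq p i j hj).DeltaTheta
          ((ThetaSetting.modelχq p i j hj).toTheta σ₀) x' =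
        x' * (E.logUdd ^ (-(2 * Multiplicative.toAdd ((ThetaSetting.modelχq p i j hj).toZ σ₀)))
          * E.kumYdd (E.toKddHat (ThetaSetting.modelχq p i j hj).qddUnit) ^
              (-(Multiplicative.toAdd ((ThetaSetting.modelχq p i j hj).toZ σ₀) *
                Multiplicative.toAdd ((ThetaSetting.modelχq p i j hj).toZ σ₀)))
          * E.kumYdd (E.toKddHat uσ₀))) :
    ∃ y : (ThetaSetting.modelχq p i j hj).H1 (ThetaSetting.modelχq p i j hj).GtpYdd,
      haveI := (ThetaSetting.modelχq p i j hj).compat.GtpYdd_normal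
      ContH1.conj (ThetaSetting.modelχq p i j hj).toTheta (ThetaSetting.modelχq p i j hj).DeltaTheta σ E.etaDd =
        ContH1.conj (ThetaSetting.modelχq p i j hj).toTheta (ThetaSetting.modelχq p i j hj).DeltaTheta σ₀ E.etaDd *
          y ^ M :=
  conj_etaDd_eq_mul_pow (E := E) (ThetaSetting.modelχq p i j hj).compat hx' ha huσ huσ₀ hσ hσ₀

/-- **[IUTchII] Prop. 1.5 (iii) closer `conj_rootLift_div_mem_range_pow` AT THE STAGE-2 MODEL FAMILY `modelχq p i j`,
`Compat` AND `IsEtThOrigin` supplied** (the refuted-closure FACT head F-2498 discharged at the carrier by the CLOSED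
producer `ThetaSetting.modelχq_isEtThOrigin`, abc-iut-L2-t5; `Compat` by `ThetaSetting.compat`, abc-iut-w5-d017): at
every `g ∈ Π^tp_Ÿ̲̲ ∩ chiKer(M)` the two conjugate `l·Δ_Θ`-valued root cocycles differ by an `N`-th power (`M = lN`),
for EVERY étale-theta datum `E` over the model, every choice `C` of `X̲̲` and every mod-`M` cyclotome identification
`μ` — ZERO `Prop`-fact binders. [claim: Mochizuki2012, status: disputed] (IUTchII §1 Prop 1.5 (iii), kurims p.29)
[cite: MochizukiEtTh2009, Prop 1.5 (iii) p.23] -/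
theorem conj_rootLift_div_mem_range_pow_modelχq {M : ℕ+} (μ : (ThetaSetting.modelχq p i j hj).CyclotomeMod l M)
    {N : ℕ} (hMN : (M : ℕ) = l * N) {σ σ₀ : Pi C}
    (y : (ThetaSetting.modelχq p i j hj).H1 (ThetaSetting.modelχq p i j hj).GtpYdd)
    (hy : haveI := (ThetaSetting.modelχq p i j hj).compat.GtpYdd_normal
      ContH1.conj (ThetaSetting.modelχq p i j hj).toTheta (ThetaSetting.modelχq p i j hj).DeltaTheta
          (σ : (ThetaSetting.modelχq p i j hj).PiTemp) E.etaDd =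
        ContH1.conj (ThetaSetting.modelχq p i j hj).toTheta (ThetaSetting.modelχq p i j hj).DeltaTheta
          (σ₀ : (ThetaSetting.modelχq p i j hj).PiTemp) E.etaDd * y ^ (M : ℕ))
    (g : ↥(PiYdd C ⊓ ⊤)) (hg : (g : Pi C) ∈ chiKer C M) :
    haveI := piYdd_normal C (ThetaSetting.modelχq p i j hj).compat
    haveI : ((ThetaSetting.modelχq p i j hj).lDeltaTheta l).Normal := ThetaSetting.lDeltaTheta_normal _ l
    haveI : IsMulCommutative ((ThetaSetting.modelχq p i j hj).lDeltaTheta l) :=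
      EtaleThetaDataOfSetting.instIsMulCommutative_lDeltaTheta (D := ThetaSetting.modelχq p i j hj) l
    ((ContH1.conjCocycle (phi C) ((ThetaSetting.modelχq p i j hj).lDeltaTheta l) σ₀ (rootLiftCocycle C)).1 g)⁻¹ *
        (ContH1.conjCocycle (phi C) ((ThetaSetting.modelχq p i j hj).lDeltaTheta l) σ (rootLiftCocycle C)).1 g ∈
      (powMonoidHom N : (ThetaSetting.modelχq p i j hj).lDeltaTheta l →*
        (ThetaSetting.modelχq p i j hj).lDeltaTheta l).range :=
  conj_rootLift_div_mem_range_pow C (ThetaSetting.modelχq p i j hj).compat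
    (ThetaSetting.modelχq_isEtThOrigin p i j hj) μ hMN y hy g hg

end EtaleThetaDataOfSetting

end Literature.IUT.HodgeArakelov

end
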